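import Summits.ABC.IUTFork.Repair.RHRound4TLinearRho
import HarnessLib

/-!
# INV-6 lens `strengthen` / `negation` (away from the model point) on crux `ThetaPartII` — THE INDUCTION FLOOR:
# every label-inductive strengthening of the typed Cor. 3.12 has a step below the Masser floor; a genuine violation of the (P)-sufficiency is a Szpiro-ratio event

abc-iut cell, crux `stmt-ABC-19678` `Summit.ABC.ABC.Theses.IUTThetaPilot.ThetaPartII` (rank 2; line RESHAPE-4 3177a83aca8d622d ▸
`stub_cor312PerImage` / `stub_cor312Bad`); seat abc-iut-inv-6 (planner; KEY `wake/KEY-abc-iut-inv-6-INV-STRENGTHEN-NEGATION.md`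
31dbb8da93a71e6d, director-abc g7 rq131). Kernel companion of the memo `INV6-STRENGTHEN-NEGATION-NO-LINE.md` (this seat). Written BY NAME over
the R-TL currency of record (★ p545946 `RHRound4TLinear`: `Variant`, `S`, `countSum`, `Estar`, `print107`, `print13`; rider `RHRound4TLinearRho`)
exactly as abc-iut-idea-1 g2's `L1CountFloorSketch.lean` (`six_le_Estar_iff`: `6 ≤ E⋆ ↔ 3μ₀S_f ≤ l·Σpk`; READING: a scheme with `E⋆ < 6` derives a
Szpiro-shape exponent `< 6` with sub-linear error and is refuted by `Literature.Barriers.ABC.SzpiroEpsilonCannotBeDropped` /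
`Literature.Barriers.ABC.Masser.masser_theorem`).

WHAT IS TYPED (lens (a) «a STRONGER uniform statement S⁺ admitting an INDUCTION on the procession length»). An induction on the procession
`{1 … l⋆}` proves the averaged inequality from per-STEP inequalities; in the currency a step is a sub-scheme of print's `(j², j+1, ·, 1, l)`. The
ONE-LABEL step is abc-iut-inv-4's `INV4PerLabelFloor.singleLabel` (`E⋆ = 2l/(j−1)`, below the floor exactly on `j > l/3 + 1`; `Cruxes/ThetaPartII/
INV4PerLabelFloor.lean`, cited, not re-typed). This file types the BLOCK and CHAIN steps:
* §1 TOP SEGMENTS (`topSeg l a` = print restricted to labels `a … l⋆`; `topSeg 107 1 = print107`): at `l = 107` the segment `[12,53]` has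
  `E⋆ = 301098/50491 (= 5.963…) < 6` while `[11,53]` sits EXACTLY at `6` and `[1,53]` at `u(107) = 6.2287…` (`topSeg107_12`, `topSeg107_11`);
  at `l = 13`: `[5,6]` has `E⋆ = 338/59 < 6`, `[4,6]` has `468/74 > 6` (`topSeg13_5`, `topSeg13_4`). In closed form `E⋆[a,l⋆] < 6 ↔
  Σ_{j=a}^{l⋆} (j+1)(3j − 2l⋆ − 4) > 0`, threshold `a ≈ √(2l⋆)`: a top-down induction, or any decomposition of the procession into consecutive blocks
  whose last block starts above label `≈ √l`, has a block below the floor — although every LABEL in `[12,36]` is individually inside the window.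
* §2 CHAIN (`chain l`: the step «label `j+1` against label `j`», increment demand `(j+1)² − j² = 2j+1`, ONE new tensor factor per step):
  `E⋆(chain 107) = 107/27 (= 3.96…)`, `E⋆(chain 13) = 26/7` (`chain107_Estar`, `chain13_Estar`) — the consecutive-label induction is below the
  floor at every level (limit `4l/(l+1)`).
READING (prose; the currency asserts no derivation): with height-free capacities (H3 of census O-38) the procession AVERAGE is not decomposable into
sound steps — print's full scheme sits `u(l)/6 = 1 + (4l+12)/(l²+l−12)` above the floor (`L1CountFloor.countPrint_div_floor`) and every proper
top block / top label / increment falls below it; an S⁺ «uniform in the procession length» is therefore either unsound (Masser) or carries the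
deficit of the lower labels as a hypothesis, i.e. restates the average (`ObstructionSS28Window.statement_iff_avg_cellSlack`, LP duality). DOWNWARD,
every S⁺ ⇒ `stub_cor312PerImage` ⇒ the uniform tame Szpiro-six family (abc-iut-inv-1's `InvEmbed.tameSzpiroSix_of_parent` over
`PointDict.szpiro_of_cor312PerImageAtDatum_tame_six`, p437841): no S⁺ is weaker than Szpiro-six on `U`.

WHAT IS TYPED (lens (b) «an explicit configuration violating the inequality AS TYPED in a toy strictly smaller than the model point»).
§3 `ratio_lt_of_not_sufficiency`: pure real arithmetic on the hypothesis of abc-iut's UNCONDITIONAL per-image sufficiency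
`Cor22.cor312PerImageOf_ratPoint_of_le` (p-file `LDHGenuinePerImageUnconditional`): if that hypothesis FAILS at `(λ, l)` (the only way a genuine
rational datum can even be a candidate violator of `stub_cor312PerImage`), then `log q^{∤{2,l}}(λ) > 6(l²−1)/(l²+l−12) · log 𝔣^{∤{2,l}}(λ)` — an
avoid-Szpiro ratio above `6(l²−1)/(l²+l−12)` (`> 5.93` at `l = 13`, `→ 6`), i.e. in Frey-triple terms an abc quality-type ratio above `≈ 3`; the
container upper bound of record decides no tabulated cell (FINDINGS §T.10 (B)), so no violation AS TYPED is constructible from the 573 tabulated data,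
and a constructed one would be a new high-merit abc triple. The typed obstruction met is the companion-prime subsidy (the Frey `S`-unit identity) —
abc itself, not a crux short of the summit (memo § Negation).

HONESTY: real arithmetic on OUR claim-tagged cell currency; a law fitted ≠ a theorem; computed ≠ proved; typed ≠ proved; nothing here asserts abc
proved or refuted; NO side is taken on [IUTchIII] Cor. 3.12 / [IUTchIV] Thm. 1.10 or on any author (D-0045); no summit statement is proved by this
seat. [claim: Mochizuki2012, status: disputed] [cite: Mochizuki2012, IUTchIV Thm. 1.10 Step (iv)–(viii) p. 27–29; IUTchIII Prop. 3.2, Cor. 3.12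
p. 173–174] [cite: Masser1990, Theorem]
-/

noncomputable section

open Finset

set_option linter.dupNamespace false

namespace Summit.ABC.ABC.Cruxes.ThetaPartII.StrengthenFloor

open Summit.ABC.IUTFork.Repair.RH.Round4TLinear
open Summit.ABC.IUTFork.Repair.RH.ReqsideWeightLaws

/-! ## §1. TOP SEGMENTS: print restricted to labels `a … l⋆` -/

/-- Print's scheme restricted to the top segment of labels `a … l⋆` (`l⋆ = (l−1)/2`): the last block of a top-down induction, or of any
decomposition of the procession into consecutive blocks. A PARAMETER record; asserted of nothing. [folklore] -/
def topSeg (l a : ℕ) : Variant := ⟨fun i => (i : ℤ) ^ 2, fun i => (i : ℝ) + 1, Finset.Icc a ((l - 1) / 2), 1, l⟩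

/-- The full segment is print's scheme of record (`print107`, p545946). [folklore] -/
theorem topSeg107_one : topSeg 107 1 = print107 := rfl

/-- **`l = 107`, segment `[12, 53]`**: `Σpk = 1407`, `S_f = 50491`, `E⋆ = 2·107·1407/50491 = 301098/50491 (= 5.963…) < 6` — below the floor.
[folklore] -/
theorem topSeg107_12 : countSum (topSeg 107 12) = 1407 ∧ S (topSeg 107 12) = 50491 ∧ Estar (topSeg 107 12) = 301098 / 50491 ∧
    Estar (topSeg 107 12) < 6 := by
  have hC : countSum (topSeg 107 12) = 1407 := by
    unfold countSum topSeg
    norm_num [Finset.sum_Icc_succ_top]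
  have hS : S (topSeg 107 12) = 50491 := by
    unfold S topSeg
    norm_num [Finset.sum_Icc_succ_top]
  have hE : Estar (topSeg 107 12) = 301098 / 50491 := by
    unfold Estar
    rw [hS, hC]
    unfold topSeg
    norm_num
  exact ⟨hC, hS, hE, by rw [hE]; norm_num⟩

/-- **`l = 107`, segment `[11, 53]`**: `Σpk = 1419`, `S_f = 50611`, `E⋆ = 303666/50611 = 6` EXACTLY — the threshold block; `[1,53]` is print at
`u(107) = 6.2287…` (`L1CountFloor.floor_107`). [folklore] -/
theorem topSeg107_11 : countSum (topSeg 107 11) = 1419 ∧ S (topSeg 107 11) = 50611 ∧ Estar (topSeg 107 11) = 6 := by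
  have hC : countSum (topSeg 107 11) = 1419 := by
    unfold countSum topSeg
    norm_num [Finset.sum_Icc_succ_top]
  have hS : S (topSeg 107 11) = 50611 := by
    unfold S topSeg
    norm_num [Finset.sum_Icc_succ_top]
  refine ⟨hC, hS, ?_⟩
  unfold Estar
  rw [hS, hC]
  unfold topSeg
  norm_num

/-- **`l = 13`, segment `[5, 6]`**: `Σpk = 13`, `S_f = 59`, `E⋆ = 338/59 (= 5.73) < 6`. [folklore] -/
theorem topSeg13_5 : countSum (topSeg 13 5) = 13 ∧ S (topSeg 13 5) = 59 ∧ Estar (topSeg 13 5) = 338 / 59 ∧ Estar (topSeg 13 5) < 6 := by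
  have hC : countSum (topSeg 13 5) = 13 := by
    unfold countSum topSeg
    norm_num [Finset.sum_Icc_succ_top]
  have hS : S (topSeg 13 5) = 59 := by
    unfold S topSeg
    norm_num [Finset.sum_Icc_succ_top]
  have hE : Estar (topSeg 13 5) = 338 / 59 := by
    unfold Estar
    rw [hS, hC]
    unfold topSeg
    norm_num
  exact ⟨hC, hS, hE, by rw [hE]; norm_num⟩

/-- **`l = 13`, segment `[4, 6]`**: `Σpk = 18`, `S_f = 74`, `E⋆ = 468/74 (= 6.32) > 6` — at `l = 13` the threshold sits between labels `4` and `5`.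
[folklore] -/
theorem topSeg13_4 : countSum (topSeg 13 4) = 18 ∧ S (topSeg 13 4) = 74 ∧ Estar (topSeg 13 4) = 468 / 74 ∧ 6 < Estar (topSeg 13 4) := by
  have hC : countSum (topSeg 13 4) = 18 := by
    unfold countSum topSeg
    norm_num [Finset.sum_Icc_succ_top]
  have hS : S (topSeg 13 4) = 74 := by
    unfold S topSeg
    norm_num [Finset.sum_Icc_succ_top]
  have hE : Estar (topSeg 13 4) = 468 / 74 := by
    unfold Estar
    rw [hS, hC]
    unfold topSeg
    norm_num
  exact ⟨hC, hS, hE, by rw [hE]; norm_num⟩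

/-! ## §2. The CHAIN: consecutive-label increments, one new tensor factor per step -/

/-- The consecutive-label scheme: step `j ↦ j+1` with increment demand `(j+1)² − j² = 2j + 1` (value-law entry `f(j) = 2j + 2`), ONE
identification per step (`pk = 1`), steps `j = 1 … l⋆ − 1`, `μ₀ = 1`. A PARAMETER record; asserted of nothing. [folklore] -/
def chain (l : ℕ) : Variant := ⟨fun i => 2 * (i : ℤ) + 2, fun _ => 1, Finset.Icc 1 ((l - 1) / 2 - 1), 1, l⟩

/-- **`E⋆(chain 107) = 2·107·52/2808 = 107/27 (= 3.96…) < 6`** (`S_f = Σ_{j=1}^{52}(2j+1) = 52·54 = 2808`, `Σpk = 52`). [folklore] -/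
theorem chain107_Estar : countSum (chain 107) = 52 ∧ S (chain 107) = 2808 ∧ Estar (chain 107) = 107 / 27 ∧ Estar (chain 107) < 6 := by
  have hC : countSum (chain 107) = 52 := by
    unfold countSum chain
    simp [Finset.sum_const, Nat.card_Icc]
  have hS : S (chain 107) = 2808 := by
    unfold S chain
    norm_num [Finset.sum_Icc_succ_top]
  have hE : Estar (chain 107) = 107 / 27 := by
    unfold Estar
    rw [hS, hC]
    unfold chain
    norm_num
  exact ⟨hC, hS, hE, by rw [hE]; norm_num⟩

/-- **`E⋆(chain 13) = 2·13·5/35 = 26/7 (= 3.71…) < 6`** (`S_f = Σ_{j=1}^{5}(2j+1) = 35`, `Σpk = 5`). [folklore] -/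
theorem chain13_Estar : countSum (chain 13) = 5 ∧ S (chain 13) = 35 ∧ Estar (chain 13) = 26 / 7 ∧ Estar (chain 13) < 6 := by
  have hC : countSum (chain 13) = 5 := by
    unfold countSum chain
    simp [Finset.sum_const, Nat.card_Icc]
  have hS : S (chain 13) = 35 := by
    unfold S chain
    norm_num [Finset.sum_Icc_succ_top]
  have hE : Estar (chain 13) = 26 / 7 := by
    unfold Estar
    rw [hS, hC]
    unfold chain
    norm_num
  exact ⟨hC, hS, hE, by rw [hE]; norm_num⟩

/-! ## §3. Lens (b): a genuine candidate violator is a Szpiro-ratio event -/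

/-- **Violation of the (P)-sufficiency is an avoid-Szpiro-ratio event.** Pure real arithmetic on the hypothesis of abc-iut's
`Cor22.cor312PerImageOf_ratPoint_of_le` (`LDHGenuinePerImageUnconditional`), with `Q = log q^{∤{2,l}}(λ)`, `C = log 𝔣^{∤{2,l}}(λ)` and `B ≥ 0`
the datum's `log l` / `log π` bonus: if `((l+1)/24 − 1/(2l))·Q ≤ ((l+5)/4 − 1)·((1 − 1/l)·C) + B` FAILS, then `Q > 6(l²−1)/(l²+l−12)·C`.
So a genuine rational datum at which `stub_cor312PerImage` is not already settled by the sufficiency has avoid-Szpiro ratio above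
`6(l²−1)/(l²+l−12)` (`= 6·168/170 > 5.93` at `l = 13`; `→ 6`). [folklore] -/
theorem ratio_lt_of_not_sufficiency {l Q C B : ℝ} (hl : 5 ≤ l) (hB : 0 ≤ B)
    (h : ¬ ((l + 1) / 24 - 1 / (2 * l)) * Q ≤ ((l + 5) / 4 - 1) * ((1 - 1 / l) * C) + B) :
    6 * (l ^ 2 - 1) / (l ^ 2 + l - 12) * C < Q := by
  replace h := not_le.mp h
  have hl0 : (0 : ℝ) < l := by linarith
  have hl1 : (l : ℝ) ≠ 0 := hl0.ne'
  have hden : (0 : ℝ) < l ^ 2 + l - 12 := by nlinarith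
  have e1 : ((l + 1) / 24 - 1 / (2 * l)) * Q * (24 * l) = (l ^ 2 + l - 12) * Q := by
    field_simp
    ring
  have e2 : (((l + 5) / 4 - 1) * ((1 - 1 / l) * C) + B) * (24 * l) = 6 * (l ^ 2 - 1) * C + 24 * l * B := by
    field_simp
    ring
  have h24 : (0 : ℝ) < 24 * l := by linarith
  have hmul := mul_lt_mul_of_pos_right h h24
  rw [e1, e2] at hmul
  have hkey : 6 * (l ^ 2 - 1) * C < (l ^ 2 + l - 12) * Q := by nlinarith
  rw [div_mul_eq_mul_div, div_lt_iff₀ hden]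
  linarith [hkey]

/-- The threshold at `l = 13`: `6(l²−1)/(l²+l−12) = 1008/170 (= 5.929…)`; and it exceeds `6(1 − 1/l)` at every `l ≥ 5`. [folklore] -/
theorem ratio_threshold_13 : (6 * ((13 : ℝ) ^ 2 - 1) / (13 ^ 2 + 13 - 12)) = 1008 / 170 ∧
    ∀ l : ℝ, 5 ≤ l → 6 * (1 - 1 / l) < 6 * (l ^ 2 - 1) / (l ^ 2 + l - 12) := by
  refine ⟨by norm_num, fun l hl => ?_⟩
  have hl0 : (0 : ℝ) < l := by linarith
  have hden : (0 : ℝ) < l ^ 2 + l - 12 := by nlinarith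
  rw [lt_div_iff₀ hden]
  have : 6 * (1 - 1 / l) * (l ^ 2 + l - 12) = 6 * (l ^ 2 - 1) - 6 * (12 - 12 / l) := by
    field_simp
    ring
  rw [this]
  have h12 : 0 < 12 - 12 / l := by
    rw [sub_pos, div_lt_iff₀ hl0]; linarith
  linarith

end Summit.ABC.ABC.Cruxes.ThetaPartII.StrengthenFloor

end
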